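import Literature.NumberTheory.GaloisCohomology.Howard2004.DVRSettingPiRefinement
import Literature.NumberTheory.GaloisCohomology.Howard2004.DVRSettingPiRefinementRings
import Literature.NumberTheory.GaloisCohomology.Howard2004.SelfOrthogonalBaseChangeProofs
import Literature.NumberTheory.GaloisCohomology.Howard2004.ResidualDualityDatumProofs
import Literature.NumberTheory.GaloisCohomology.Howard2004.DVRLevelSelmerFiniteProofs
import Literature.NumberTheory.GaloisRepresentations.UnramifiedClassesInertia
import HarnessLib

/-!
# Howard 2004, Remark 1.3.1: H.4 — the exact self-orthogonality of the local conditions — HOLDS on every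
# level `T^{(k)}/π^jT^{(k)}` of the `π`-adic refinement of a `DVRSetting` with H.0–H.5 (theorems only)

Topic `NumberTheory/GaloisCohomology/Howard2004` (brick «R4b» of the refinement constructor «REFINE» of seat
`bsd-line-x10b-p1-w2` g16; INSTANTIATION of `bsd-line-x10b-p1` LEAD g12's generic base-change theorem
`DualityDatum.isSelfOrthogonalAt_propagateStructure` (`SelfOrthogonalBaseChangeProofs`) for the quotients
`T^{(k)} ↠ T^{(k)}/π^j T^{(k)}` and the reduced H.4 data of «R4a» (`PiAdicRefinementDualityDatumProofs`); cell
`pub/bsd-print-x9`, seat `bsd-line-x10b-p1-w8` g10).  THEOREMS ONLY: no definition, no named fact, no instance, no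
notation, no `sorry`.

WHY (INPUTS row G87 = `Howard2004.thm161_dvrKolyvaginBound` = Howard Thm. 1.6.1; stub `stub_h161` of the μ-crux
stmt-BirchSwinnertonDyer-22642).  LEAD g11's ruling (β) on the «LEVEL-GAP»: Lemma 1.6.4 is proved on the FULL tower, so
the refined setting `S♯` (levels `T/π^{i}T`) must satisfy `SatisfiesH`, clause `h4 : (S♯.D i).IsSelfOrthogonal (S♯.t i).cond`
included — Howard's Remark 1.3.1 «hypotheses H.0–H.5 are stable under base change» (arXiv:1202.6340 p. 7 L125–127)
for H.4 «the local condition `𝓕` is its own exact orthogonal complement under `⟨ , ⟩_v`» (p. 7 L78–82).  The generic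
theorem needs, for the presentation `π̄ : T^{(k)} ↠ T^{(k)}/π^j` (over `R`, `I = (π^j)`): a forward value map `ψ`
(here w2 g16's `toQuotRing : R_k → R/π^j`), a backward injective equivariant `f : T^{(k)}/π^j → T^{(k)}` with a value
map `μ` (here the LEVEL INCLUSION `ι_j [s] = π^{e_k-j} s`, Howard's `T/𝔪^iT →(π^{k-i}) T[𝔪^i] ⊂ T`, Remark 1.1.4,
and `μ(r mod π^j) = π̄^{e_k-j} r ∈ R_k`), and the `f`-cartesian identity of the condition at `v` and `σ v` (on
`Σ(F)`: H.3 for `T^{(k)}` over `R_k`; off `Σ(F)`: «unramified cartesian», Lemma 1.1.5).  This file supplies them.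

* §1 the level inclusion: **`DVRSetting.exists_levelInclusion`** (`∃ ι : T^{(k)}/π^j →ₗ[R] T^{(k)}, ι [s] = π^{e_k-j} s`),
  `levelInclusion_equivariant`, `levelInclusion_injective` (H.0: exact `π`-divisibility);
* §2 the value maps: **`DVRSetting.exists_levelValueMap`** (`∃ μ : R/π^j →+ R_k, μ (r mod π^j) = π̄^{e_k-j}·r̄`), its
  `ℤ_p`-linearity `levelValueMap_padicInt` (w2 g16's `algebraMap_padicInt_levelRing`), the backward compatibility
  `e_levelInclusion_eq` (`e(s, ι t̄) = μ(ē([s], t̄))`) and the forward one `toQuotRing_padicInt_mul`;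
* §3 the cartesian identities for `ι` at EVERY finite place: `propagateStructure_modIdeal_inr_eq_comap_of_mem` (`Σ(F)`:
  `SatisfiesH.h3`, the quotient read as an `R_k`-module through `toQuotRing`), `…_of_not_mem` (unramified cartesian:
  both modules unramified, `ι` injective, cocycle criterion `oneCocycleClass_mem_unramifiedSubgroup_iff_forall_eq_zero`),
  **`propagateStructure_modIdeal_inr_eq_comap`**;
* §4 **`DVRSetting.isSelfOrthogonal_propagateStructure_modIdeal`**: for `1 ≤ j ≤ e_k` and ANY H.4 datum `Dj` on
  `T^{(k)}/π^jT^{(k)}` over `R/π^j` with `Dj.e [s] [t] = toQuotRing (e_k(s,t))` (R4a delivers one),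
  `Dj.IsSelfOrthogonal ((isQuotientBy_modIdeal …).propagateStructure (S.t k).cond)` — H.4 at exponent `j`; and the
  reading on the refinement datum's `Level j` / `proj` (`isSelfOrthogonal_propagateStructure_levelRep`).

HONEST FRAMING: instantiation plumbing over LEAD g12's theorem and Howard's H.3/H.4 for `T^{(k)}`; the refined
`DVRSetting` (R3/R5/R6), Lemma 1.6.4 and `thm161_dvrKolyvaginBound` are NOT proved; no summit statement is proved; the
Birch–Swinnerton-Dyer conjecture is not proved by any of this.
References: [Howard2004HeegnerKolyvagin] §1.3 H.3–H.4, Rem. 1.3.1, Rem. 1.1.4, Def. 1.1.2–1.1.3, Lemma 1.1.5 (arXiv p. 7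
L65–82, L125–127; p. 5 L88–105; p. 6 L14–24); [MazurRubinMemoirs2004] Lemma 1.1.9, Lemma 3.7.1; [NeukirchSchmidtWingberg2008]
I §4 (1.4.2); [MilneADT2006] I §2.
-/

set_option autoImplicit false

noncomputable section

open Function NumberField IsDedekindDomain Field
open scoped NumberField ContRepresentation Pointwise

namespace Literature.NumberTheory.GaloisCohomology.Howard2004

open CategoryTheory
open Literature.NumberTheory.GaloisRepresentations
open Literature.NumberTheory.GaloisRepresentations.DiscreteGaloisModule
open Literature.NumberTheory.GaloisCohomology.Howard2004.LevelRaising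

namespace DVRSetting

variable {p : ℕ} [Fact p.Prime] {K : Type} [Field K] [NumberField K]
  {R : Type} [CommRing R] [IsDomain R] [IsDiscreteValuationRing R] [Algebra ℤ_[p] R]
  {N : ℕ → Type} [∀ k, AddCommGroup (N k)] [∀ k, TopologicalSpace (N k)]
  [∀ k, DiscreteTopology (N k)] [∀ k, Module R (N k)]
  {Rk : ℕ → Type} [∀ k, CommRing (Rk k)] [∀ k, IsLocalRing (Rk k)] [∀ k, TopologicalSpace (Rk k)]
  [∀ k, DiscreteTopology (Rk k)] [∀ k, Algebra ℤ_[p] (Rk k)] [∀ k, Algebra R (Rk k)]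
  [∀ k, Module (Rk k) (N k)] [∀ k, IsScalarTower R (Rk k) (N k)]
  {Nbar : Type} [AddCommGroup Nbar] [TopologicalSpace Nbar] [DiscreteTopology Nbar]
  [∀ k, Module (Rk k) Nbar]
  {Nq : ℕ → Finset (HeightOneSpectrum (𝓞 K)) → Type} [∀ k n, AddCommGroup (Nq k n)]
  [∀ k n, TopologicalSpace (Nq k n)] [∀ k n, DiscreteTopology (Nq k n)]
  [∀ k n, Module (Rk k) (Nq k n)] [∀ k n, Module R (Nq k n)]
  [∀ k n, IsScalarTower R (Rk k) (Nq k n)]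
  (S : DVRSetting p K R N Rk Nbar Nq)

/-! ## §1 The level inclusion `ι_j : T^{(k)}/π^jT^{(k)} ↪ T^{(k)}`, `ι [s] = π^{e_k-j} s` -/

/-- **The level inclusion exists**: multiplication by `π^{e_k-j}` kills `π^j T^{(k)}` (`π^{e_k} T^{(k)} = 0`), so it
factors through an `R`-linear `ι : T^{(k)}/π^jT^{(k)} → T^{(k)}` with `ι [s] = π^{e_k-j} s` — the `Quot(T^{(k)})`-morphism
`T/π^j → T/π^{e_k} = T^{(k)}` «induced by `π^{e_k-j}`» (Def. 1.1.3, Remark 1.1.4).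
[cite: Howard2004HeegnerKolyvagin, Def. 1.1.3 and Rem. 1.1.4 (arXiv p. 5 L93–105)] -/
theorem exists_levelInclusion (hy : S.SatisfiesH) {j k : ℕ} (h : j ≤ S.e k) :
    ∃ ι : (N k ⧸ Ideal.span {S.π ^ j} • (⊤ : Submodule R (N k))) →ₗ[R] N k,
      ∀ s : N k, ι (Submodule.Quotient.mk s) = S.π ^ (S.e k - j) • s := by
  have hker : Ideal.span {S.π ^ j} • (⊤ : Submodule R (N k)) ≤
      LinearMap.ker (S.π ^ (S.e k - j) • (LinearMap.id : N k →ₗ[R] N k)) := by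
    refine Submodule.smul_le.mpr fun r hr y _ => ?_
    obtain ⟨a, rfl⟩ := Ideal.mem_span_singleton'.1 hr
    rw [LinearMap.mem_ker, LinearMap.smul_apply, LinearMap.id_apply, smul_smul, mul_comm a, ← mul_assoc, ← pow_add,
      Nat.sub_add_cancel h, mul_smul]
    exact hy.killed k _ (Ideal.pow_mem_pow (S.π_mem_maximalIdeal hy) _) _
  exact ⟨(Ideal.span {S.π ^ j} • (⊤ : Submodule R (N k))).liftQ _ hker, fun s => rfl⟩

/-- The level inclusion is `Γ_K`-equivariant (for the quotient action `modIdeal`).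
[cite: Howard2004HeegnerKolyvagin, Def. 1.1.3 (arXiv p. 5 L93–99)] -/
theorem levelInclusion_equivariant {j k : ℕ}
    (ι : (N k ⧸ Ideal.span {S.π ^ j} • (⊤ : Submodule R (N k))) →ₗ[R] N k)
    (hι : ∀ s : N k, ι (Submodule.Quotient.mk s) = S.π ^ (S.e k - j) • s) (σ : absoluteGaloisGroup K)
    (x : N k ⧸ Ideal.span {S.π ^ j} • (⊤ : Submodule R (N k))) :
    ι (modIdeal (S.T.ρ k) (S.T.hlin k) (Ideal.span {S.π ^ j}) σ x) = S.T.ρ k σ (ι x) := by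
  obtain ⟨s, rfl⟩ := Submodule.Quotient.mk_surjective _ x
  rw [modIdeal_apply_mk, hι, hι, S.T.hlin k]

/-- **The level inclusion is injective** (`j ≤ e_k`): `π^{e_k-j} s = 0` forces `s ∈ π^j T^{(k)}` (H.0: exact `π`-divisibility
on the free `R_k = R/π^{e_k}`-module `T^{(k)}`). [cite: Howard2004HeegnerKolyvagin, Def. 1.1.2, Rem. 1.1.4 and H.0 (arXiv p. 5 L88–105, p. 7 L57)] -/
theorem levelInclusion_injective (hy : S.SatisfiesH) {j k : ℕ} (h : j ≤ S.e k)
    (ι : (N k ⧸ Ideal.span {S.π ^ j} • (⊤ : Submodule R (N k))) →ₗ[R] N k)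
    (hι : ∀ s : N k, ι (Submodule.Quotient.mk s) = S.π ^ (S.e k - j) • s) : Function.Injective ι := by
  haveI := (hy.h0 k).1
  refine (injective_iff_map_eq_zero _).2 fun x hx => ?_
  obtain ⟨s, rfl⟩ := Submodule.Quotient.mk_surjective _ x
  rw [hι] at hx
  obtain ⟨s', rfl⟩ := exists_eq_pow_smul_of_pow_smul_eq_zero S.π (S.π_ne_zero hy) (S.e k)
    (hy.algebraMap_surjective k) (S.ker_algebraMap_le hy k) (Nat.sub_le _ _) s hx
  rw [Nat.sub_sub_self h, Submodule.Quotient.mk_eq_zero]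
  exact Submodule.smul_mem_smul (Ideal.mem_span_singleton_self _) Submodule.mem_top

/-- `(r̄) • [s] = [r • s]` for the `R/π^j`-module structure of the quotient. [cite: Howard2004HeegnerKolyvagin, Def. 1.1.3 (arXiv p. 5 L93–99: T/IT over R/I)] -/
theorem mk_smul_mk {j k : ℕ} (r : R) (s : N k) :
    (Ideal.Quotient.mk (Ideal.span {S.π ^ j}) r) •
        (Submodule.Quotient.mk s : N k ⧸ Ideal.span {S.π ^ j} • (⊤ : Submodule R (N k))) =
      Submodule.Quotient.mk (r • s) := rfl

/-! ## §2 The value maps: `ψ = toQuotRing : R_k → R/π^j` (forward) and `μ : R/π^j → R_k` (backward) -/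

/-- **The backward value map `μ : R/π^j → R_k`, `μ (r mod π^j) = π̄^{e_k-j} · r̄`** (well defined for `j ≤ e_k`:
`π^{e_k-j}·π^j = π^{e_k} ∈ ker (R → R_k)`) — the embedding of `R/π^j` onto the ideal `π̄^{e_k-j}R_k` through which the
backward compatibility `e(s, ι t̄) = μ(ē([s], t̄))` holds. [cite: Howard2004HeegnerKolyvagin, Rem. 1.1.4 and Rem. 1.3.1 (arXiv p. 5 L100–105, p. 7 L125–127)] -/
theorem exists_levelValueMap (hy : S.SatisfiesH) {j k : ℕ} (h : j ≤ S.e k) :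
    ∃ μ : S.QuotRing j →+ Rk k, ∀ r : R, μ (Ideal.Quotient.mk _ r) = algebraMap R (Rk k) (S.π ^ (S.e k - j) * r) := by
  let f : R →ₗ[R] Rk k := (Algebra.linearMap R (Rk k)).comp (LinearMap.mulLeft R (S.π ^ (S.e k - j)))
  have hf : ∀ r, f r = algebraMap R (Rk k) (S.π ^ (S.e k - j) * r) := fun _ => rfl
  have hker : (Ideal.span {S.π ^ j} : Submodule R R) ≤ LinearMap.ker f := by
    intro r hr
    obtain ⟨a, rfl⟩ := Ideal.mem_span_singleton'.1 hr
    rw [LinearMap.mem_ker, hf, mul_comm a, ← mul_assoc, ← pow_add, Nat.sub_add_cancel h, ← RingHom.mem_ker,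
      hy.ker_algebraMap]
    exact Ideal.mul_mem_right _ _ (Ideal.pow_mem_pow (S.π_mem_maximalIdeal hy) _)
  exact ⟨((Ideal.span {S.π ^ j}).liftQ f hker).toAddMonoidHom, fun r => hf r⟩

/-- `μ` is `ℤ_p`-linear (the level ring's `ℤ_p`-structure is the one through `R`, w2 g16's `algebraMap_padicInt_levelRing`).
[cite: Howard2004HeegnerKolyvagin, §1.3 H.4 (arXiv p. 7 L69–73: R(1))] -/
theorem levelValueMap_padicInt (hy : S.SatisfiesH) {j k : ℕ} (μ : S.QuotRing j →+ Rk k)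
    (hμ : ∀ r : R, μ (Ideal.Quotient.mk _ r) = algebraMap R (Rk k) (S.π ^ (S.e k - j) * r))
    (c : ℤ_[p]) (b : S.QuotRing j) : μ (algebraMap ℤ_[p] (S.QuotRing j) c * b) = algebraMap ℤ_[p] (Rk k) c * μ b := by
  obtain ⟨r, rfl⟩ := Ideal.Quotient.mk_surjective b
  rw [IsScalarTower.algebraMap_apply ℤ_[p] R (S.QuotRing j) c, Ideal.Quotient.algebraMap_eq, ← map_mul, hμ, hμ,
    S.algebraMap_padicInt_levelRing hy k]
  rw [← map_mul]
  congr 1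
  ring

/-- `toQuotRing` is `ℤ_p`-linear in the additive sense the base-change theorem asks. [cite: Howard2004HeegnerKolyvagin, §1.3 H.4 (arXiv p. 7 L69–73)] -/
theorem toQuotRing_padicInt_mul (hy : S.SatisfiesH) {j k : ℕ} (h : j ≤ S.e k) (c : ℤ_[p]) (a : Rk k) :
    (S.toQuotRing hy h : Rk k →+ S.QuotRing j) (algebraMap ℤ_[p] (Rk k) c * a) =
      algebraMap ℤ_[p] (S.QuotRing j) c * (S.toQuotRing hy h : Rk k →+ S.QuotRing j) a := by
  change S.toQuotRing hy h (algebraMap ℤ_[p] (Rk k) c * a) = algebraMap ℤ_[p] (S.QuotRing j) c * S.toQuotRing hy h a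
  rw [map_mul, S.toQuotRing_algebraMap_padicInt hy h]

/-- **The backward compatibility `e(s, ι t̄) = μ(ē([s], t̄))`** for any H.4 datum `Dj` on `T^{(k)}/π^j` with
`ē([s],[t]) = toQuotRing (e(s,t))`: both sides are `π̄^{e_k-j} e(s, t)`. [cite: Howard2004HeegnerKolyvagin, Rem. 1.1.4 and Rem. 1.3.1 (arXiv p. 5 L100–105, p. 7 L125–127)] -/
theorem e_levelInclusion_eq (hy : S.SatisfiesH) {j k : ℕ} (h : j ≤ S.e k)
    (ι : (N k ⧸ Ideal.span {S.π ^ j} • (⊤ : Submodule R (N k))) →ₗ[R] N k)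
    (hι : ∀ s : N k, ι (Submodule.Quotient.mk s) = S.π ^ (S.e k - j) • s)
    (μ : S.QuotRing j →+ Rk k) (hμ : ∀ r : R, μ (Ideal.Quotient.mk _ r) = algebraMap R (Rk k) (S.π ^ (S.e k - j) * r)) :
    letI := S.quotRingTopology j
    haveI := S.quotRing_discreteTopology j
    ∀ (Dj : DualityDatum p S.cd (modIdeal (S.T.ρ k) (S.T.hlin k) (Ideal.span {S.π ^ j})) (S.QuotRing j)),
      (∀ s t : N k, Dj.e (Submodule.Quotient.mk s) (Submodule.Quotient.mk t) = S.toQuotRing hy h ((S.D k).e s t)) →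
      ∀ (s : N k) (x : N k ⧸ Ideal.span {S.π ^ j} • (⊤ : Submodule R (N k))),
        (S.D k).e s (ι x) = μ (Dj.e (Submodule.Quotient.mk s) x) := by
  intro Dj hDj s x
  obtain ⟨t, rfl⟩ := Submodule.Quotient.mk_surjective _ x
  obtain ⟨r, hr⟩ := hy.algebraMap_surjective k ((S.D k).e s t)
  rw [hι, hDj, ← hr, S.toQuotRing_algebraMap hy h, hμ, ← algebraMap_smul (Rk k) (S.π ^ (S.e k - j)) t, map_smul,
    smul_eq_mul, ← hr, ← map_mul]

/-! ## §3 The cartesian identities for `ι` at every finite place -/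

/-- `T^{(k)}` is unramified off `Σ(F)`, hence so is the quotient `T^{(k)}/π^j`: the inertia group acts trivially on it.
[cite: Howard2004HeegnerKolyvagin, Def. 1.1.10 (arXiv p. 6 L14–24)] -/
theorem toLocal_modIdeal_apply_eq_self_of_not_mem (hy : S.SatisfiesH) {j k : ℕ} (v : HeightOneSpectrum (𝓞 K))
    (hv : (Sum.inr v : Place K) ∉ S.Sigma) {τ : absoluteGaloisGroup (v.adicCompletion K)}
    (hτ : τ ∈ absInertia (v.adicCompletion K)) (x : N k ⧸ Ideal.span {S.π ^ j} • (⊤ : Submodule R (N k))) :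
    GaloisRep.toLocal v (modIdeal (S.T.ρ k) (S.T.hlin k) (Ideal.span {S.π ^ j})) τ x = x := by
  have hvk : (Sum.inr v : Place K) ∉ (S.t k).Sigma := by rwa [hy.Sigma_eq]
  have hur : GaloisRep.IsUnramifiedAt v (S.T.ρ k) :=
    not_not.1 fun h' => hvk ((S.t k).isHoward.mem_of_ramified v h')
  obtain ⟨s, rfl⟩ := Submodule.Quotient.mk_surjective _ x
  rw [GaloisRep.toLocal_apply, modIdeal_apply_mk]
  exact congrArg _ (GaloisRep.toLocal_apply_eq_self_of_isUnramifiedAt _ hur hτ s)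

/-- **The cartesian identity at `v ∈ Σ(F)`**: the condition propagated to `T^{(k)}/π^j` is the `ι_*`-preimage of `F_{k,v}`
— H.3 for `T^{(k)}` over `R_k` (`SatisfiesH.h3`), applied to the presentations `T^{(k)} ↠ T^{(k)}/π^j` (read as an
`R_k`-module through `toQuotRing`), `id : T^{(k)} ↠ T^{(k)}/0`, and the injective `Quot`-morphism `ι` («×π̄^{e_k-j}»).
[cite: Howard2004HeegnerKolyvagin, H.3 and Def. 1.1.2–1.1.3 (arXiv p. 7 L65–67, p. 5 L88–99)] [cite: MazurRubinMemoirs2004, Lemma 3.7.1] -/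
theorem propagateStructure_modIdeal_inr_eq_comap_of_mem (hy : S.SatisfiesH) {j k : ℕ} (h : j ≤ S.e k)
    (ι : (N k ⧸ Ideal.span {S.π ^ j} • (⊤ : Submodule R (N k))) →ₗ[R] N k)
    (hι : ∀ s : N k, ι (Submodule.Quotient.mk s) = S.π ^ (S.e k - j) • s)
    (hequiv : ∀ (σ : absoluteGaloisGroup K) x,
      ι (modIdeal (S.T.ρ k) (S.T.hlin k) (Ideal.span {S.π ^ j}) σ x) = S.T.ρ k σ (ι x))
    (v : Place K) (hv : v ∈ S.Sigma) :
    (isQuotientBy_modIdeal (S.T.ρ k) (S.T.hlin k) (Ideal.span {S.π ^ j})).propagateStructure (S.t k).cond v =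
      ((S.t k).cond v).comap
        (ContinuousRep.cohomologyMap ((modIdeal (S.T.ρ k) (S.T.hlin k) (Ideal.span {S.π ^ j})).toLocal v)
          ((S.T.ρ k).toLocal v) ι.toAddMonoidHom continuous_of_discreteTopology (fun _ x => hequiv _ x) 1) := by
  -- the quotient as an `R_k`-module through `toQuotRing : R_k → R/π^j`
  letI instQ : Module (Rk k) (N k ⧸ Ideal.span {S.π ^ j} • (⊤ : Submodule R (N k))) :=
    Module.compHom _ (S.toQuotRing hy h)
  have hsmulQ : ∀ (r : R) (q : N k ⧸ Ideal.span {S.π ^ j} • (⊤ : Submodule R (N k))),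
      (algebraMap R (Rk k) r) • q = r • q := by
    intro r q
    change (S.toQuotRing hy h (algebraMap R (Rk k) r)) • q = r • q
    rw [S.toQuotRing_algebraMap hy h]
    obtain ⟨s, rfl⟩ := Submodule.Quotient.mk_surjective _ q
    rfl
  set ϖ : Rk k := algebraMap R (Rk k) S.π with hϖ
  -- the presentation `T^{(k)} ↠ T^{(k)}/π^j` and the morphism `ι`, `R_k`-linearly
  let πI : N k →ₗ[Rk k] (N k ⧸ Ideal.span {S.π ^ j} • (⊤ : Submodule R (N k))) :=
    { toFun := Submodule.Quotient.mk
      map_add' := fun _ _ => rfl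
      map_smul' := fun a s => by
        obtain ⟨r, rfl⟩ := hy.algebraMap_surjective k a
        rw [RingHom.id_apply, hsmulQ, algebraMap_smul, Submodule.Quotient.mk_smul] }
  let f : (N k ⧸ Ideal.span {S.π ^ j} • (⊤ : Submodule R (N k))) →ₗ[Rk k] N k :=
    { toFun := ι
      map_add' := map_add ι
      map_smul' := fun a x => by
        obtain ⟨r, rfl⟩ := hy.algebraMap_surjective k a
        rw [RingHom.id_apply, hsmulQ, map_smul, algebraMap_smul] }
  have hI : IsQuotientBy (S.T.ρ k) (Ideal.span {ϖ ^ j})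
      (modIdeal (S.T.ρ k) (S.T.hlin k) (Ideal.span {S.π ^ j})) πI :=
    { surjective := Submodule.Quotient.mk_surjective _
      ker_eq := by
        ext x
        rw [LinearMap.mem_ker]
        change (Submodule.Quotient.mk x : N k ⧸ Ideal.span {S.π ^ j} • (⊤ : Submodule R (N k))) = 0 ↔ _
        rw [Submodule.Quotient.mk_eq_zero, S.mem_span_pi_pow_smul_top_iff]
      equivariant := fun _ _ => rfl }
  have hJ : IsQuotientBy (S.T.ρ k) (⊥ : Ideal (Rk k)) (S.T.ρ k) LinearMap.id :=
    { surjective := Function.surjective_id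
      ker_eq := by rw [LinearMap.ker_id, Submodule.bot_smul]
      equivariant := fun _ _ => rfl }
  have hf : IsQuotMorphism (S.T.ρ k) (Ideal.span {ϖ ^ j}) ⊥
      (modIdeal (S.T.ρ k) (S.T.hlin k) (Ideal.span {S.π ^ j})) πI (S.T.ρ k) LinearMap.id (ϖ ^ (S.e k - j)) f :=
    { smul_le := fun x hx => by
        obtain ⟨a, rfl⟩ := Ideal.mem_span_singleton'.1 hx
        rw [Ideal.mem_bot, mul_comm a, ← mul_assoc, ← pow_add, Nat.sub_add_cancel h, hϖ, S.algebraMap_pi_pow_e hy k,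
          zero_mul]
      comp_eq := fun m => by
        change ι (Submodule.Quotient.mk m) = ϖ ^ (S.e k - j) • (m : N k)
        rw [hι, hϖ, ← map_pow, algebraMap_smul]
      equivariant := hequiv }
  have hv' : v ∈ (S.t k).Sigma := by rwa [hy.Sigma_eq]
  have hcart := hy.h3 k v hv' _ _ _ (N k) _ πI (S.T.ρ k) LinearMap.id hI hJ _ f hf
    (S.levelInclusion_injective hy h ι hι)
  rw [hJ.propagate_of_id] at hcart
  exact hcart

/-- **The cartesian identity at a finite `v ∉ Σ(F)`** («unramified cartesian», Lemma 1.1.5): the condition propagated to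
`T^{(k)}/π^j` is `H¹_ur` (`propagateStructure_inr_eq_unramifiedSubgroup`) and `ι_*⁻¹(H¹_ur(K_v, T^{(k)})) = H¹_ur(K_v, T^{(k)}/π^j)`
(both modules unramified at `v`, `ι` injective, cocycle criterion). [cite: Howard2004HeegnerKolyvagin, Def. 1.1.10 and Lemma 1.1.5 (arXiv p. 6 L14–24, p. 7 L116–118)] [cite: MazurRubinMemoirs2004, Lemma 1.1.9] -/
theorem propagateStructure_modIdeal_inr_eq_comap_of_not_mem (hy : S.SatisfiesH) {j k : ℕ} (h : j ≤ S.e k)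
    (ι : (N k ⧸ Ideal.span {S.π ^ j} • (⊤ : Submodule R (N k))) →ₗ[R] N k)
    (hι : ∀ s : N k, ι (Submodule.Quotient.mk s) = S.π ^ (S.e k - j) • s)
    (hequiv : ∀ (σ : absoluteGaloisGroup K) x,
      ι (modIdeal (S.T.ρ k) (S.T.hlin k) (Ideal.span {S.π ^ j}) σ x) = S.T.ρ k σ (ι x))
    (v : HeightOneSpectrum (𝓞 K)) (hv : (Sum.inr v : Place K) ∉ S.Sigma) :
    (isQuotientBy_modIdeal (S.T.ρ k) (S.T.hlin k) (Ideal.span {S.π ^ j})).propagateStructure (S.t k).cond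
        (Sum.inr v) =
      ((S.t k).cond (Sum.inr v)).comap
        (ContinuousRep.cohomologyMap ((modIdeal (S.T.ρ k) (S.T.hlin k) (Ideal.span {S.π ^ j})).toLocal (Sum.inr v))
          ((S.T.ρ k).toLocal (Sum.inr v)) ι.toAddMonoidHom continuous_of_discreteTopology (fun _ x => hequiv _ x)
          1) := by
  haveI : Finite (N k) := S.finite_level hy k
  have hvk : (Sum.inr v : Place K) ∉ (S.t k).Sigma := by rwa [hy.Sigma_eq]
  have hur : GaloisRep.IsUnramifiedAt v (S.T.ρ k) :=
    not_not.1 fun h' => hvk ((S.t k).isHoward.mem_of_ramified v h')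
  have hcond : (S.t k).cond (Sum.inr v) =
      DiscreteGaloisModule.unramifiedSubgroup (GaloisRep.toLocal v (S.T.ρ k)) 1 :=
    (S.t k).isHoward.isUnramifiedOutside.2 v hvk
  rw [(isQuotientBy_modIdeal (S.T.ρ k) (S.T.hlin k) (Ideal.span {S.π ^ j})).propagateStructure_inr_eq_unramifiedSubgroup
    (S.t k).cond hcond hur, hcond]
  have hI : ∀ τ ∈ absInertia (v.adicCompletion K), ∀ w : N k, GaloisRep.toLocal v (S.T.ρ k) τ w = w :=
    fun _ hτ w => GaloisRep.toLocal_apply_eq_self_of_isUnramifiedAt _ hur hτ w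
  have hIQ : ∀ τ ∈ absInertia (v.adicCompletion K), ∀ x : N k ⧸ Ideal.span {S.π ^ j} • (⊤ : Submodule R (N k)),
      GaloisRep.toLocal v (modIdeal (S.T.ρ k) (S.T.hlin k) (Ideal.span {S.π ^ j})) τ x = x :=
    fun _ hτ x => S.toLocal_modIdeal_apply_eq_self_of_not_mem hy v hv hτ x
  ext c
  obtain ⟨z, rfl⟩ := oneCocycleClass_surjective _ c
  change _ ↔ ContinuousRep.cohomologyMap ((modIdeal (S.T.ρ k) (S.T.hlin k) (Ideal.span {S.π ^ j})).toLocal (Sum.inr v))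
      ((S.T.ρ k).toLocal (Sum.inr v)) ι.toAddMonoidHom continuous_of_discreteTopology (fun _ x => hequiv _ x) 1
      (oneCocycleClass _ z) ∈ DiscreteGaloisModule.unramifiedSubgroup (GaloisRep.toLocal v (S.T.ρ k)) 1
  rw [cohomologyMap_one_oneCocycleClass]
  refine (DiscreteGaloisModule.oneCocycleClass_mem_unramifiedSubgroup_iff_forall_eq_zero
    (GaloisRep.toLocal v (modIdeal (S.T.ρ k) (S.T.hlin k) (Ideal.span {S.π ^ j}))) hIQ z).trans
    (Iff.trans (forall₂_congr fun τ _ => ?_)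
      (DiscreteGaloisModule.oneCocycleClass_mem_unramifiedSubgroup_iff_forall_eq_zero
        (GaloisRep.toLocal v (S.T.ρ k)) hI _).symm)
  change z.1 τ = 0 ↔ ι (z.1 τ) = 0
  exact (map_eq_zero_iff _ (S.levelInclusion_injective hy h ι hι)).symm

/-- **The cartesian identity for `ι` at EVERY finite place** (`Σ(F)` / off `Σ(F)`). [cite: Howard2004HeegnerKolyvagin, H.3, Def. 1.1.2–1.1.3, Lemma 1.1.5 (arXiv p. 7 L65–67, p. 5 L88–99, p. 6 L14–24)] -/
theorem propagateStructure_modIdeal_inr_eq_comap (hy : S.SatisfiesH) {j k : ℕ} (h : j ≤ S.e k)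
    (ι : (N k ⧸ Ideal.span {S.π ^ j} • (⊤ : Submodule R (N k))) →ₗ[R] N k)
    (hι : ∀ s : N k, ι (Submodule.Quotient.mk s) = S.π ^ (S.e k - j) • s)
    (hequiv : ∀ (σ : absoluteGaloisGroup K) x,
      ι (modIdeal (S.T.ρ k) (S.T.hlin k) (Ideal.span {S.π ^ j}) σ x) = S.T.ρ k σ (ι x))
    (v : HeightOneSpectrum (𝓞 K)) :
    (isQuotientBy_modIdeal (S.T.ρ k) (S.T.hlin k) (Ideal.span {S.π ^ j})).propagateStructure (S.t k).cond
        (Sum.inr v) =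
      ((S.t k).cond (Sum.inr v)).comap
        (ContinuousRep.cohomologyMap ((modIdeal (S.T.ρ k) (S.T.hlin k) (Ideal.span {S.π ^ j})).toLocal (Sum.inr v))
          ((S.T.ρ k).toLocal (Sum.inr v)) ι.toAddMonoidHom continuous_of_discreteTopology (fun _ x => hequiv _ x)
          1) := by
  by_cases hv : (Sum.inr v : Place K) ∈ S.Sigma
  · exact S.propagateStructure_modIdeal_inr_eq_comap_of_mem hy h ι hι hequiv (Sum.inr v) hv
  · exact S.propagateStructure_modIdeal_inr_eq_comap_of_not_mem hy h ι hι hequiv v hv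

/-! ## §4 H.4 on the levels `T^{(k)}/π^j T^{(k)}` -/

/-- **Howard's Remark 1.3.1 for H.4 on a `DVRSetting` with H.0–H.5: the propagated local conditions on
`T^{(k)}/π^jT^{(k)}` are their own EXACT orthogonal complements** under the pairing of ANY reduced H.4 datum `Dj`
(`Dj.e [s] [t] = toQuotRing (e_k(s,t))`, `1 ≤ j ≤ e_k`; R4a `exists_dualityDatum_modIdeal` delivers one) — LEAD g12's
`DualityDatum.isSelfOrthogonalAt_propagateStructure` instantiated with `ψ = toQuotRing`, `f = ι_j`, `μ`, the cartesian
identities of §3 at `v` and `σ v`, and `SatisfiesH.h4 k`.  This is the clause `h4` of `SatisfiesH` for the refined setting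
at exponent `j`. [cite: Howard2004HeegnerKolyvagin, §1.3 H.4 and Rem. 1.3.1 (arXiv p. 7 L69–82, L125–127)] -/
theorem isSelfOrthogonal_propagateStructure_modIdeal (hy : S.SatisfiesH) {j k : ℕ} (h : j ≤ S.e k) :
    letI := S.quotRingTopology j
    haveI := S.quotRing_discreteTopology j
    ∀ (Dj : DualityDatum p S.cd (modIdeal (S.T.ρ k) (S.T.hlin k) (Ideal.span {S.π ^ j})) (S.QuotRing j)),
      (∀ s t : N k, Dj.e (Submodule.Quotient.mk s) (Submodule.Quotient.mk t) = S.toQuotRing hy h ((S.D k).e s t)) →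
      Dj.IsSelfOrthogonal
        ((isQuotientBy_modIdeal (S.T.ρ k) (S.T.hlin k) (Ideal.span {S.π ^ j})).propagateStructure (S.t k).cond) := by
  letI := S.quotRingTopology j
  haveI := S.quotRing_discreteTopology j
  intro Dj hDj v
  obtain ⟨ι, hι⟩ := S.exists_levelInclusion hy h
  have hequiv := S.levelInclusion_equivariant ι hι
  obtain ⟨μ, hμ⟩ := S.exists_levelValueMap hy h
  exact DualityDatum.isSelfOrthogonalAt_propagateStructure
    (isQuotientBy_modIdeal (S.T.ρ k) (S.T.hlin k) (Ideal.span {S.π ^ j})) (S.D k) Dj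
    (S.toQuotRing hy h : Rk k →+ S.QuotRing j) (S.toQuotRing_padicInt_mul hy h) (fun s t => hDj s t)
    ι.toAddMonoidHom hequiv μ (S.levelValueMap_padicInt hy μ hμ) (S.e_levelInclusion_eq hy h ι hι μ hμ Dj hDj)
    (S.t k).cond v
    (S.propagateStructure_modIdeal_inr_eq_comap hy h ι hι hequiv v)
    (S.propagateStructure_modIdeal_inr_eq_comap hy h ι hι hequiv (S.cd.σ • v))
    (hy.h4 k v)

/-! ## §5 The same read on the refinement datum's `Level j` (`levelRep`, `proj`) -/

omit [IsDomain R] [IsDiscreteValuationRing R] [Algebra ℤ_[p] R] in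
/-- `H¹` of two pointwise-equal equivariant maps agree. [cite: SerreGaloisCohomology1997, I §2.2] -/
theorem cohomologyMap_one_congr {M₁ M₂ : Type} [AddCommGroup M₁] [TopologicalSpace M₁] [DiscreteTopology M₁]
    [AddCommGroup M₂] [TopologicalSpace M₂] [DiscreteTopology M₂] {F : Type} [Field F]
    (τ₁ : DiscreteGaloisModule F M₁) (τ₂ : DiscreteGaloisModule F M₂) (a b : M₁ →+ M₂)
    (ha : ∀ (g : absoluteGaloisGroup F) (x : M₁), a (τ₁ g x) = τ₂ g (a x))
    (hb : ∀ (g : absoluteGaloisGroup F) (x : M₁), b (τ₁ g x) = τ₂ g (b x)) (h : ∀ x, a x = b x)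
    (c : galoisCohomology τ₁ 1) :
    ContinuousRep.cohomologyMap τ₁ τ₂ a continuous_of_discreteTopology ha 1 c =
      ContinuousRep.cohomologyMap τ₁ τ₂ b continuous_of_discreteTopology hb 1 c := by
  obtain ⟨z, rfl⟩ := oneCocycleClass_surjective _ c
  rw [cohomologyMap_one_oneCocycleClass, cohomologyMap_one_oneCocycleClass]
  congr 1
  refine Subtype.ext (ContinuousMap.ext fun g => ?_)
  exact h _

/-- The structure propagated along the refinement datum's presentation `proj : T^{(k)} ↠ Level j` (at the host `k`) is
the structure propagated along the quotient map (`proj = mkQ ∘ redLE (le_refl k)` and `redLE (le_refl k) = id`).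
[cite: Howard2004HeegnerKolyvagin, Def. 1.1.3 (arXiv p. 5 L93–99)] -/
theorem propagateStructure_levelRep_eq (hy : S.SatisfiesH) (j : ℕ) :
    ((S.piRefinementDatum hy).isQuotientBy_levelRep (le_refl ((S.piRefinementDatum hy).host j))).propagateStructure
        (S.t ((S.piRefinementDatum hy).host j)).cond =
      (isQuotientBy_modIdeal (S.T.ρ ((S.piRefinementDatum hy).host j)) (S.T.hlin _)
        (Ideal.span {S.π ^ j})).propagateStructure (S.t ((S.piRefinementDatum hy).host j)).cond := by
  funext v
  rw [IsQuotientBy.propagateStructure_apply, IsQuotientBy.propagateStructure_apply]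
  ext c
  constructor
  · rintro ⟨x, hx, rfl⟩
    refine ⟨x, hx, ?_⟩
    exact (cohomologyMap_one_congr _ _ _ _ _ _ (fun y => by
      change Submodule.Quotient.mk y = (S.piRefinementDatum hy).proj le_rfl y
      rw [PiRefinementDatum.proj_apply, (S.piRefinementDatum hy).red_refl]) _)
  · rintro ⟨x, hx, rfl⟩
    refine ⟨x, hx, ?_⟩
    exact (cohomologyMap_one_congr _ _ _ _ _ _ (fun y => by
      change (S.piRefinementDatum hy).proj le_rfl y = Submodule.Quotient.mk y
      rw [PiRefinementDatum.proj_apply, (S.piRefinementDatum hy).red_refl]) _)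

/-- **H.4 at exponent `j` on the `π`-adic refinement datum** (`D := S.piRefinementDatum hy`, host `k := D.host j`): for ANY
H.4 datum `Dj` on `D.Level j` with its action `D.levelRep j` over `R ⧸ (D.π^j)` reducing `S.D k` along `D.proj`
(`Dj.e (proj s) (proj t) = toQuotRing (e_k(s,t))`; R4a `exists_levelDualityDatum` delivers one), the structure
propagated along `D.proj` is its own exact orthogonal complement — the `h4` clause of `SatisfiesH` for the refined
setting in w2 g16's (R3/R6) currency. [cite: Howard2004HeegnerKolyvagin, §1.3 H.4 and Rem. 1.3.1 (arXiv p. 7 L69–82, L125–127)] -/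
theorem isSelfOrthogonal_propagateStructure_levelRep (hy : S.SatisfiesH) (j : ℕ) :
    letI : TopologicalSpace (R ⧸ Ideal.span {(S.piRefinementDatum hy).π ^ j}) := ⊥
    haveI : DiscreteTopology (R ⧸ Ideal.span {(S.piRefinementDatum hy).π ^ j}) := ⟨rfl⟩
    ∀ (Dj : DualityDatum p S.cd ((S.piRefinementDatum hy).levelRep j)
        (R ⧸ Ideal.span {(S.piRefinementDatum hy).π ^ j})),
      (∀ s t : N ((S.piRefinementDatum hy).host j),
        Dj.e ((S.piRefinementDatum hy).proj le_rfl s) ((S.piRefinementDatum hy).proj le_rfl t) =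
          S.toQuotRing hy ((S.piRefinementDatum hy).le_e_host j) ((S.D ((S.piRefinementDatum hy).host j)).e s t)) →
      Dj.IsSelfOrthogonal
        (((S.piRefinementDatum hy).isQuotientBy_levelRep (le_refl ((S.piRefinementDatum hy).host j))).propagateStructure
          (S.t ((S.piRefinementDatum hy).host j)).cond) := by
  letI : TopologicalSpace (R ⧸ Ideal.span {(S.piRefinementDatum hy).π ^ j}) := ⊥
  haveI : DiscreteTopology (R ⧸ Ideal.span {(S.piRefinementDatum hy).π ^ j}) := ⟨rfl⟩
  intro Dj hDj
  rw [S.propagateStructure_levelRep_eq hy j]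
  have hDj' : ∀ s t : N ((S.piRefinementDatum hy).host j),
      Dj.e (Submodule.Quotient.mk s) (Submodule.Quotient.mk t) =
        S.toQuotRing hy ((S.piRefinementDatum hy).le_e_host j) ((S.D ((S.piRefinementDatum hy).host j)).e s t) := by
    intro s t
    have h := hDj s t
    rwa [PiRefinementDatum.proj_apply, PiRefinementDatum.proj_apply, (S.piRefinementDatum hy).red_refl,
      (S.piRefinementDatum hy).red_refl] at h
  exact S.isSelfOrthogonal_propagateStructure_modIdeal hy ((S.piRefinementDatum hy).le_e_host j) Dj hDj'

end DVRSetting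

end Literature.NumberTheory.GaloisCohomology.Howard2004

end
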